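import Summits.QuantumFields.BalabanUV.T4Continuum.Spine.NE1p.DressedSmallFieldNestedToriWitness
import Literature.MathematicalPhysics.QuantumFieldTheory.Balaban1983to89.B13Ineq232
import Literature.MathematicalPhysics.QuantumFieldTheory.Balaban1983to89.B12Decay510Window

/-!
# T⁴ programme, spine estimate NE1′ (node O3b/H2) — THE THREE-CUBE ROD OF THE FINE TORUS: CLOSURE ONE COARSE BLOCK (`5 ≤ L`),
# TORUS TREE LENGTH EXACTLY ONE (PART 1 of row W67 «THE (2.36) TRANSFER IS EXERCISED»; geometry + PART 2's toy DATA)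

Cell `pub-balaban`, sub-cell `t4`, BINDER-OWNERS row NE1′ (owner skeleton `t4/skeletons/NE1p-t4-ne1p-p1.md`); crew
`b2b-balaban-t4-ne1p-formalise-*`, row **W67 ∕ DAG N29zzzt** of `t4/formal/NE1p/LEAVES.md` (RESERVED by typer RULING R-T137, CLAIMS.log l.22015, on INTENT l.21891;
booked at PROTOTYPE + STAGED & READY l.22071 — the FOLLOWER the typer NAMED when booking W59, RULING R-T133 (ii)(a): «a positive-length interior box at
L ≥ 5 = a follower»), unit `b2b-balaban-t4-ne1p-formalise-leaf-10` (gen 11).  ADDITIVE —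
imports W59.1 `Spine/NE1p/DressedSmallFieldNestedToriWitness` (p237070; for its imports: pv22 `TreeLengthTorusGeometry236` → `TreeLengthTorusTransfer`
(`tcoarse`, `tblock`, `tclosure`, `tclosureDom`), S43.1 `Support/TorusBlockRefinement` (`natLift_proj_of_range`), W24 `X₀`) and the Literature modules
`B13Ineq232` (`faceConnected_pair`, `faceConnected_insert`) and `B12Decay510Window` (`dist_le_len`) ONLY; nothing of pv22 ∕ S43 ∕ S47 ∕ W59 restated.

WHAT THIS FILE IS (kernel geometry on pv22's nested tori `TPt 4 (L·N′)` → `TPt 4 N′`, every `N′`):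
* §1 THE ROD (toy DATA): the window cubes `p_j := (⌊L∕2⌋ − 1 + j, ⌊L∕2⌋, ⌊L∕2⌋, ⌊L∕2⌋)`, `j = 0, 1, 2`, consecutive ones wall-adjacent (`B13ScaleTransfer.Adj`), the
  window rod `rodW L := {p₀, p₁, p₂}` — FACE-CONNECTED (`B13Ineq232.faceConnected_pair` + `faceConnected_insert` BY NAME) — and its torus image
  `rodT L N′ := rodW.image (proj (L·N′))`, a torus localization domain `C_R : TDom 4 (L·N′)` (`TreeLengthTorus.tFaceConnected_image` BY NAME).
* §2 **THE CLOSURE OF THE ROD IS ONE COARSE BLOCK for `5 ≤ L`**: every cube of the rod's 3⁴-collar has window coordinates in `[⌊L∕2⌋ − 2, ⌊L∕2⌋ + 2] ⊂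
  [0, L − 1]`, so it coarsens to block `0` (pv22 `tcoarse_proj`, S43.1 `natLift_proj_of_range` BY NAME; W59.1's one-cube pattern `tcoarse_eq_zero_of_mem_tblock_cL`
  at three cubes): `tclosure L N′ rodT = {0}`, `tclosureDom L N′ C_R = X₀ N′`.  FALSE at `L = 4` (the collar of `p₂` reaches coordinate `4 = L`): holder mutant.
* §3 **THE TORUS TREE LENGTH OF THE ROD IS EXACTLY ONE** (`5 ≤ L`; pv22's `torusTreeLen` = [Balaban1987RGI] p. 257's linear size d_j on the periodic
  carrier, READING D-pv22g2.1): `≤ 1` by the explicit admissible unit segment `[(corner p₁, corner p₂)]` (it lies in `cube p₁`, `corner p₁ ∈ cube p₀`,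
  `corner p₂ ∈ cube p₂`; `TreeLengthTorus.tAdmissible_of_admissible` + `torusTreeLen_le_len` BY NAME); `≥ 1` by `TreeLengthTorus.le_torusTreeLen` and B12's
  `dist_le_len`: a torus-admissible graph meets lifts `x₀ ≡ p₀`, `x₂ ≡ p₂ (mod L·N′)` (`TreeLengthTorusGeometry.exists_period_of_proj_eq`) whose
  0-coordinates differ by `2 + (L·N′)·k`, so it contains two points at sup-distance `≥ 1` (`k ≥ 0`: gap `≥ 1`; `k ≤ −1`: gap `≥ L·N′ − 3 ≥ 2`).  To the
  crew's knowledge the first EXACT positive torus tree length of an explicit domain in the tree (S47's `torusTreeLen_trefine_singleton_ge` is pv22's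
  volume lower bound).  PART 2 (`…NestedToriRodWitness`) fires S44's nested-tori END on the datum whose component is `C_R`: there the (2.36)∕(2.35)
  transfer is PRICED — the inner weight is `e^{−R₀·1} < 1`, not W59's `e^{−R₀·0} = 1`.
* §4 toy DATA for PART 2 over W59.1's shapes: the covered label `coveredR := ⟨∅, ⟨{X₀}, ↦ ⟨C_R, ()⟩⟩⟩`, the index `termsR` (it and W59.1's
  `uncoveredN` at `X₀`, nothing elsewhere), the activity `actR` (W59.1's label-indexed cores `GN` summed over `termsR` along W33's pencil).

HONEST FRAMING.  Finite lattice∕polygonal-graph geometry ([folklore]); a DECIDED TOY domain — the rod and the block size are OURS; print's ½L, «L an odd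
positive integer > 11» ([Balaban1987RGI] p. 251), (2.35)–(2.39) of [Balaban1988RGII] are TYPE∕CONTEXT only; WHICH tori∕blocks are Bałaban's = pv22's
READING (D-pv22.3); no numeral of the audited manuscripts is asserted as a fact about Bałaban's densities; 0 binders instantiated on Bałaban's densities;
discharges no wall item; wall v1.8 (T4-DAG v48) — words, not kind — does NOT move; R-t4r2-Q2 NOT met; NE1′ ⇐ the named binders — NOT proved, NOT printed;
spine PROVED 0∕9; count 9 unchanged; 0 sorry, 0 `def … : Prop`, 0 cite of anything internally minted.  Rung (B)+1 on ONE finite four-torus — NOT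
infinite volume, NOT a mass gap, NOT OS on ℝ⁴, NOT Clay.  HONEST DEPENDENCY: continuum YM on T⁴ ⇐ BetaPertH ∧ nine spine estimates (0/9 proved);
BetaPertH ⇐ (D1) ∧ (D4) ∧ CAP+tail; G-an2-4 gates asym, D1 and NE2/3/4.
-/

noncomputable section

namespace Summit.QuantumFields.BalabanUV.T4Continuum.NE1p.DressedSmallFieldNestedToriRod

open Set Metric
open Literature.MathematicalPhysics.QuantumFieldTheory.Balaban1983to89
open Literature.MathematicalPhysics.QuantumFieldTheory.Balaban1983to89.B13ScaleTransfer (Pt Adj block mem_block coarse)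
open Literature.MathematicalPhysics.QuantumFieldTheory.Balaban1983to89.TreeLength (RPt Seg corner cube cubes mem_cube corner_mem_cube convex_cube
  cube_subset_cubes carrier len carrier_cons carrier_nil len_cons len_nil Admissible)
open Literature.MathematicalPhysics.QuantumFieldTheory.Balaban1983to89.TreeLengthTorus (TPt TDom tsys proj proj_apply natLift TFaceConnected
  tFaceConnected_image TAdmissible tAdmissible_of_admissible torusTreeLen torusTreeLen_le_len le_torusTreeLen)
open Literature.MathematicalPhysics.QuantumFieldTheory.Balaban1983to89.TreeLengthTorusGeometry (period exists_period_of_proj_eq)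
open Literature.MathematicalPhysics.QuantumFieldTheory.Balaban1983to89.TreeLengthTorusTransfer (tcoarse tcoarse_proj tblock mem_tblock_self tcollar
  tclosure tclosureDom tclosureDom_val)
open Literature.MathematicalPhysics.QuantumFieldTheory.Balaban1983to89.B13Ineq232 (faceConnected_pair faceConnected_insert)
open Literature.MathematicalPhysics.QuantumFieldTheory.Balaban1983to89.B12Decay510Window (dist_le_len)
open Summit.QuantumFields.BalabanUV.T4Continuum.TorusBlockRefinement (natLift_proj_of_range)
open Summit.QuantumFields.BalabanUV.T4Continuum.B13HistMeasurable (B13HistM)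
open Summit.QuantumFields.BalabanUV.T4Continuum.B13HistWitness (toyFrame)
open Summit.QuantumFields.BalabanUV.T4Continuum.NE1p.DressedSmallFieldCoresWitness (liveTable)
open Summit.QuantumFields.BalabanUV.T4Continuum.NE1p.DressedSmallFieldTorusWitness (X₀)
open Summit.QuantumFields.BalabanUV.T4Continuum.NE1p.DressedSmallFieldNestedToriWitness (LabelN uncoveredN GN)

/-! ## §1 THE ROD (toy DATA): three consecutive cubes of the window lattice ℤ⁴ and their image on the fine torus -/

section Rod
variable (L : ℕ)

/-- THE j-th CUBE OF THE ROD (toy DATA): `p_j := (⌊L∕2⌋ − 1 + j, ⌊L∕2⌋, ⌊L∕2⌋, ⌊L∕2⌋) ∈ ℤ⁴`. [folklore] -/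
def pR (j : ℕ) : Pt 4 := Function.update (fun _ => ((L / 2 : ℕ) : ℤ)) 0 (((L / 2 : ℕ) : ℤ) - 1 + j)

/-- Coordinate `0` of `p_j`. [folklore] -/
@[simp] theorem pR_zero (j : ℕ) : pR L j 0 = ((L / 2 : ℕ) : ℤ) - 1 + j := by
  unfold pR; rw [Function.update_self]

/-- The other coordinates of `p_j`. [folklore] -/
@[simp] theorem pR_ne (j : ℕ) {i : Fin 4} (hi : i ≠ 0) : pR L j i = ((L / 2 : ℕ) : ℤ) := by
  unfold pR; rw [Function.update_of_ne hi]

/-- Consecutive cubes of the rod: `p_{j+1} = p_j + e₀`. [folklore] -/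
theorem pR_succ (j : ℕ) : pR L (j + 1) = Function.update (pR L j) 0 (pR L j 0 + 1) := by
  unfold pR
  rw [Function.update_self, Function.update_idem]
  congr 1
  push_cast
  ring

/-- … hence wall-adjacent (`B13ScaleTransfer.Adj`). [folklore] -/
theorem adj_pR (j : ℕ) : Adj (pR L j) (pR L (j + 1)) := ⟨0, Or.inl (pR_succ L j)⟩

/-- THE WINDOW ROD (toy DATA): `{p₀, p₁, p₂} ⊂ ℤ⁴`. [folklore] -/
def rodW : Finset (Pt 4) := {pR L 0, pR L 1, pR L 2}

/-- **THE ROD IS FACE-CONNECTED** (b13's `faceConnected_pair` + `faceConnected_insert` BY NAME). [folklore] -/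
theorem faceConnected_rodW : B13ScaleTransfer.FaceConnected (rodW L) :=
  faceConnected_insert (faceConnected_pair (adj_pR L 1)) (x := pR L 1) (by simp) ⟨0, Or.inr (pR_succ L 0)⟩

variable (N' : ℕ) [NeZero L] [NeZero N']

/-- THE ROD ON THE FINE TORUS (toy DATA): the image of the window rod under `proj (L·N′)`. [folklore] -/
def rodT : Finset (TPt 4 (L * N')) := (rodW L).image (proj (L * N'))

omit [NeZero L] [NeZero N'] in
/-- `proj p_j ∈ rodT` for `j ≤ 2`. [folklore] -/
theorem proj_pR_mem {j : ℕ} (hj : j ≤ 2) : proj (L * N') (pR L j) ∈ rodT L N' := by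
  refine Finset.mem_image_of_mem _ ?_
  unfold rodW
  interval_cases j <;> simp

/-- **THE ROD IS A TORUS LOCALIZATION DOMAIN** (toy DATA; `TreeLengthTorus.tFaceConnected_image` BY NAME): the fine component `C_R : TDom 4 (L·N′)`. [folklore] -/
def CR : TDom 4 (L * N') :=
  ⟨rodT L N', ⟨(Finset.insert_nonempty _ _).image _, tFaceConnected_image (faceConnected_rodW L)⟩⟩

/-- `C_R.1 = rodT`. [folklore] -/
@[simp] theorem CR_val : (CR L N').1 = rodT L N' := rfl

end Rod

/-! ## §2 THE CLOSURE OF THE ROD IS ONE COARSE BLOCK (`5 ≤ L`) -/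

section Closure
variable (L N' : ℕ) [NeZero L] [NeZero N']

omit [NeZero L] in
/-- The rod's coordinates lie in `[⌊L∕2⌋ − 1, ⌊L∕2⌋ + 1]` (`j ≤ 2`). [arith] -/
theorem pR_bounds {j : ℕ} (hj : j ≤ 2) (i : Fin 4) : ((L / 2 : ℕ) : ℤ) - 1 ≤ pR L j i ∧ pR L j i ≤ ((L / 2 : ℕ) : ℤ) + 1 := by
  by_cases hi : i = 0
  · subst hi; rw [pR_zero]; constructor <;> push_cast <;> omega
  · rw [pR_ne L j hi]; constructor <;> linarith

/-- The standard lift of `proj p_j` is `p_j` (its coordinates lie in `[0, L·N′)` once `4 ≤ L`; S43.1 `natLift_proj_of_range`). [folklore] -/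
theorem natLift_proj_pR (hL : 5 ≤ L) {j : ℕ} (hj : j ≤ 2) : natLift (proj (L * N') (pR L j)) = pR L j := by
  refine natLift_proj_of_range fun i => ?_
  obtain ⟨hl, hu⟩ := pR_bounds L hj i
  have hN : 1 ≤ N' := Nat.one_le_iff_ne_zero.2 (NeZero.ne N')
  have h1 : (2 : ℤ) ≤ ((L / 2 : ℕ) : ℤ) := by exact_mod_cast (show 2 ≤ L / 2 by omega)
  have h2 : ((L / 2 : ℕ) : ℤ) + 2 < (L : ℤ) := by exact_mod_cast (show L / 2 + 2 < L by omega)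
  have h3 : (L : ℤ) ≤ ((L * N' : ℕ) : ℤ) := by exact_mod_cast Nat.le_mul_of_pos_right L hN
  exact ⟨by linarith, by linarith⟩

/-- **EVERY CUBE OF THE ROD's 3⁴-COLLAR COARSENS TO BLOCK 0** (kernel; needs `5 ≤ L`: the collar's coordinates `⌊L∕2⌋ − 2 … ⌊L∕2⌋ + 2` lie in `[0, L − 1]`;
pv22's `tcoarse_proj`). [folklore] -/
theorem tcoarse_eq_zero_of_mem_tblock_pR (hL : 5 ≤ L) {j : ℕ} (hj : j ≤ 2) {a : TPt 4 (L * N')}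
    (ha : a ∈ tblock (proj (L * N') (pR L j))) : tcoarse L N' a = 0 := by
  unfold tblock at ha
  rw [natLift_proj_pR L N' hL hj] at ha
  obtain ⟨y, hy, rfl⟩ := Finset.mem_image.1 ha
  rw [tcoarse_proj]
  have hy' := mem_block.1 hy
  have h1 : (2 : ℤ) ≤ ((L / 2 : ℕ) : ℤ) := by exact_mod_cast (show 2 ≤ L / 2 by omega)
  have h2 : ((L / 2 : ℕ) : ℤ) + 2 < (L : ℤ) := by exact_mod_cast (show L / 2 + 2 < L by omega)
  have hc : coarse L y = 0 := by
    funext i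
    obtain ⟨hl, hu⟩ := hy' i
    obtain ⟨hl', hu'⟩ := pR_bounds L hj i
    exact Int.ediv_eq_zero_of_lt (by linarith) (by linarith)
  rw [hc]
  funext i
  exact Int.cast_zero

/-- **THE CLOSURE OF THE ROD IS ITS BLOCK** (kernel, LOCATED): `tclosure L N′ rodT = {0}` — print's Z′ (pv22's `tclosure` = collar ∘ block map) of the three-cube
fine rod at the centre of block 0 is the ONE coarse block `0`, for every `5 ≤ L` and every `N′`. [folklore] -/
theorem tclosure_rodT (hL : 5 ≤ L) : tclosure L N' (rodT L N') = {0} := by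
  unfold tclosure tcollar
  refine Finset.eq_singleton_iff_unique_mem.2 ⟨?_, fun b hb => ?_⟩
  · exact Finset.mem_image.2 ⟨proj (L * N') (pR L 0), Finset.mem_biUnion.2 ⟨_, proj_pR_mem L N' (by norm_num), mem_tblock_self _⟩,
      tcoarse_eq_zero_of_mem_tblock_pR L N' hL (by norm_num) (mem_tblock_self _)⟩
  · obtain ⟨a, ha, rfl⟩ := Finset.mem_image.1 hb
    obtain ⟨x, hx, hax⟩ := Finset.mem_biUnion.1 ha
    unfold rodT rodW at hx
    simp only [Finset.mem_image, Finset.mem_insert, Finset.mem_singleton] at hx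
    obtain ⟨p, hp, rfl⟩ := hx
    rcases hp with rfl | rfl | rfl
    · exact tcoarse_eq_zero_of_mem_tblock_pR L N' hL (by norm_num) hax
    · exact tcoarse_eq_zero_of_mem_tblock_pR L N' hL (by norm_num) hax
    · exact tcoarse_eq_zero_of_mem_tblock_pR L N' hL (by norm_num) hax

/-- **THE CLOSURE OF THE COMPONENT IS THE COARSE UNIT BLOCK**: `tclosureDom L N′ C_R = X₀ N′` (pv22's `tclosureDom`, W24's `X₀`). [folklore] -/
theorem tclosureDom_CR (hL : 5 ≤ L) : tclosureDom L N' (CR L N') = X₀ N' :=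
  Subtype.ext (by rw [tclosureDom_val]; exact tclosure_rodT L N' hL)

end Closure

/-! ## §3 THE TORUS TREE LENGTH OF THE ROD IS EXACTLY ONE -/

section TreeLength
variable (L N' : ℕ)

/-- `corner p₂ ∈ cube p₁` (the far end of the unit segment lies on the common wall of the cubes `p₁`, `p₂`). [folklore] -/
theorem corner_pR_two_mem_cube_one : corner (pR L 2) ∈ cube (pR L 1) := by
  refine mem_cube.2 fun i => ?_
  by_cases hi : i = 0
  · subst hi; simp only [corner, pR_zero]; push_cast; constructor <;> linarith
  · simp only [corner, pR_ne L _ hi]; constructor <;> linarith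

/-- `corner p₁ ∈ cube p₀` (the near end lies on the common wall of `p₀`, `p₁`). [folklore] -/
theorem corner_pR_one_mem_cube_zero : corner (pR L 1) ∈ cube (pR L 0) := by
  refine mem_cube.2 fun i => ?_
  by_cases hi : i = 0
  · subst hi; simp only [corner, pR_zero]; push_cast; constructor <;> linarith
  · simp only [corner, pR_ne L _ hi]; constructor <;> linarith

/-- **THE UNIT SEGMENT `[corner p₁, corner p₂]` IS ADMISSIBLE FOR THE WINDOW ROD** (connected; inside `cube p₁`; meets the three cubes). [folklore] -/
theorem admissible_rodSegment : Admissible (rodW L) [(corner (pR L 1), corner (pR L 2))] := by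
  refine ⟨?_, ?_, ?_⟩
  · simp only [carrier_cons, carrier_nil, Set.union_empty]
    exact (convex_segment _ _).isConnected ⟨_, left_mem_segment ℝ _ _⟩
  · simp only [carrier_cons, carrier_nil, Set.union_empty]
    exact ((convex_cube (pR L 1)).segment_subset (corner_mem_cube _) (corner_pR_two_mem_cube_one L)).trans
      (cube_subset_cubes (by unfold rodW; simp))
  · intro x hx
    unfold rodW at hx
    simp only [Finset.mem_insert, Finset.mem_singleton] at hx
    simp only [carrier_cons, carrier_nil, Set.union_empty]
    rcases hx with rfl | rfl | rfl
    · exact ⟨corner (pR L 1), left_mem_segment ℝ _ _, corner_pR_one_mem_cube_zero L⟩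
    · exact ⟨corner (pR L 1), left_mem_segment ℝ _ _, corner_mem_cube _⟩
    · exact ⟨corner (pR L 2), right_mem_segment ℝ _ _, corner_mem_cube _⟩

/-- … hence TORUS-admissible for the rod (`TreeLengthTorus.tAdmissible_of_admissible` BY NAME: projecting never lengthens). [folklore] -/
theorem tAdmissible_rodSegment : TAdmissible (rodT L N') [(corner (pR L 1), corner (pR L 2))] :=
  tAdmissible_of_admissible (admissible_rodSegment L) rfl

/-- The unit segment has sup-metric length `1`. [arith] -/
theorem len_rodSegment : len [(corner (pR L 1), corner (pR L 2))] = 1 := by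
  rw [len_cons, len_nil, add_zero]
  have h0 : dist (corner (pR L 1) 0) (corner (pR L 2) 0) = 1 := by
    have hz : pR L 1 0 - pR L 2 0 = -1 := by rw [pR_zero, pR_zero]; push_cast; ring
    simp only [corner, Real.dist_eq]
    rw [← Int.cast_sub, hz]; norm_num
  refine le_antisymm ((dist_pi_le_iff zero_le_one).2 fun i => ?_) (h0 ▸ dist_le_pi_dist _ _ 0)
  by_cases hi : i = 0
  · subst hi; exact h0.le
  · simp only [corner, pR_ne L _ hi, dist_self]; exact zero_le_one

/-- **EVERY TORUS-ADMISSIBLE GRAPH FOR THE ROD HAS LENGTH ≥ 1** (`5 ≤ L`): it meets lifts `x₀ ≡ p₀`, `x₂ ≡ p₂ (mod L·N′)` (`exists_period_of_proj_eq`), whose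
0-coordinates differ by `2 + (L·N′)·k`; two of its points are therefore `≥ 1` apart in the sup metric, and B12's `dist_le_len` bounds the length below. [folklore] -/
theorem one_le_len_of_tAdmissible [NeZero N'] (hL : 5 ≤ L) {T : List (Seg 4)} (hT : TAdmissible (rodT L N') T) : 1 ≤ len T := by
  obtain ⟨x₀, hx₀, t₀, ht₀T, ht₀c⟩ := hT.meets _ (proj_pR_mem L N' (show 0 ≤ 2 by norm_num))
  obtain ⟨x₂, hx₂, t₂, ht₂T, ht₂c⟩ := hT.meets _ (proj_pR_mem L N' (show 2 ≤ 2 by norm_num))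
  obtain ⟨k₀, hk₀⟩ := exists_period_of_proj_eq hx₀
  obtain ⟨k₂, hk₂⟩ := exists_period_of_proj_eq hx₂
  have e₀ : x₀ 0 = ((L / 2 : ℕ) : ℤ) - 1 - ((L * N' : ℕ) : ℤ) * k₀ 0 := by
    have h := congrFun hk₀ 0
    simp only [Pi.add_apply, period, pR_zero, Nat.cast_zero, add_zero] at h
    linarith
  have e₂ : x₂ 0 = ((L / 2 : ℕ) : ℤ) + 1 - ((L * N' : ℕ) : ℤ) * k₂ 0 := by
    have h := congrFun hk₂ 0
    simp only [Pi.add_apply, period, pR_zero, Nat.cast_ofNat] at h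
    linarith
  have hN : 1 ≤ N' := Nat.one_le_iff_ne_zero.2 (NeZero.ne N')
  have hn : (5 : ℤ) ≤ ((L * N' : ℕ) : ℤ) := by exact_mod_cast le_trans hL (Nat.le_mul_of_pos_right L hN)
  have hd : x₂ 0 - x₀ 0 = 2 - ((L * N' : ℕ) : ℤ) * (k₂ 0 - k₀ 0) := by rw [e₀, e₂]; ring
  -- the two lifted cubes are ≥ 1 apart in coordinate 0
  have hgap : (1 : ℝ) ≤ |t₀ 0 - t₂ 0| := by
    obtain ⟨l₀, u₀⟩ := (mem_cube.1 ht₀c) 0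
    obtain ⟨l₂, u₂⟩ := (mem_cube.1 ht₂c) 0
    rcases lt_trichotomy (k₀ 0) (k₂ 0) with hlt | heq | hgt
    · have hm : ((L * N' : ℕ) : ℤ) * 1 ≤ ((L * N' : ℕ) : ℤ) * (k₂ 0 - k₀ 0) :=
        mul_le_mul_of_nonneg_left (by omega) (by positivity)
      have hz : x₂ 0 - x₀ 0 ≤ -3 := by linarith
      have hr : ((x₂ 0 : ℤ) : ℝ) - ((x₀ 0 : ℤ) : ℝ) ≤ -3 := by exact_mod_cast hz
      rw [le_abs]; left; linarith
    · have hz : x₂ 0 - x₀ 0 = 2 := by rw [hd, heq, sub_self, mul_zero, sub_zero]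
      have hr : ((x₂ 0 : ℤ) : ℝ) - ((x₀ 0 : ℤ) : ℝ) = 2 := by exact_mod_cast hz
      rw [le_abs]; right; linarith
    · have hm : ((L * N' : ℕ) : ℤ) * 1 ≤ ((L * N' : ℕ) : ℤ) * (k₀ 0 - k₂ 0) :=
        mul_le_mul_of_nonneg_left (by omega) (by positivity)
      have hz : 7 ≤ x₂ 0 - x₀ 0 := by linarith
      have hr : (7 : ℝ) ≤ ((x₂ 0 : ℤ) : ℝ) - ((x₀ 0 : ℤ) : ℝ) := by exact_mod_cast hz
      rw [le_abs]; right; linarith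
  calc (1 : ℝ) ≤ |t₀ 0 - t₂ 0| := hgap
    _ = dist (t₀ 0) (t₂ 0) := (Real.dist_eq _ _).symm
    _ ≤ dist t₀ t₂ := dist_le_pi_dist _ _ 0
    _ ≤ len T := dist_le_len hT.connected.isPreconnected ht₀T ht₂T

/-- **THE TORUS TREE LENGTH OF THE ROD IS EXACTLY ONE** (`5 ≤ L`, every `N′`): [Balaban1987RGI] p. 257's linear size `d_k` of the three-cube fine domain,
in pv22's READING (`torusTreeLen`; `torusTreeLen_le_len` at the unit segment, `le_torusTreeLen` with `one_le_len_of_tAdmissible`). [folklore] -/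
theorem torusTreeLen_rodT [NeZero N'] (hL : 5 ≤ L) : torusTreeLen (rodT L N') = 1 :=
  le_antisymm ((torusTreeLen_le_len (tAdmissible_rodSegment L N')).trans (len_rodSegment L).le)
    (le_torusTreeLen ⟨_, tAdmissible_rodSegment L N'⟩ fun _ hT => one_le_len_of_tAdmissible L N' hL hT)

/-- The component `C_R` has tree length `1`: in PART 2, S44's (2.36)∕(2.35) transfer is met as `ℓ·1`, not `ℓ·0`. [folklore] -/
theorem torusTreeLen_CR [NeZero L] [NeZero N'] (hL : 5 ≤ L) : torusTreeLen (CR L N').1 = 1 := torusTreeLen_rodT L N' hL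

end TreeLength

/-! ## §4 THE LABELS, THE INDEX AND THE ACTIVITY OF PART 2 (toy DATA over W59.1's `LabelN`, `uncoveredN`, `GN`) -/

section Labels
variable (L N' : ℕ) [NeZero L] [NeZero N']

/-- THE COVERED LABEL WITH THE ROD (toy DATA): nothing uncovered, the ONE family `{X₀}`, for its member the ROD of the FINE torus. [folklore] -/
def coveredR : LabelN L N' := ⟨∅, ⟨{X₀ N'}, fun _ _ => ⟨CR L N', ()⟩⟩⟩

/-- It differs from W59.1's uncovered label (first components `∅ ≠ {0}`). [folklore] -/
theorem coveredR_ne_uncoveredN : coveredR L N' ≠ uncoveredN L N' := fun h =>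
  (Finset.singleton_ne_empty (0 : TPt 4 N')).symm (congrArg Sigma.fst h)

open Classical in
/-- THE TERM INDEX OF RECORD (toy DATA): at the coarse unit block the covered-by-the-rod label and W59.1's uncovered label; nothing elsewhere. [folklore] -/
def termsR (Z : TDom 4 N') : Finset (LabelN L N') := if Z = X₀ N' then {coveredR L N', uncoveredN L N'} else ∅

open Classical in
/-- The index at `X₀`. [folklore] -/
theorem termsR_X₀ : termsR L N' (X₀ N') = {coveredR L N', uncoveredN L N'} := if_pos rfl

variable (r : ℝ) (hr : 0 ≤ r)

/-- THE ACTIVITY OF RECORD (toy DATA): the sum of W59.1's label-indexed cores' terms `GN` over the rod's index, along the pencil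
`s ↦ 0 + s • liveTable` (W33's `liveTable`). [folklore] -/
def actR (k : ℕ) (s : ℂ) (Z : (tsys 4 N').Dom) : ℂ :=
  ∑ l ∈ termsR L N' Z, (GN L N' r hr k l k).termAt (0 : ℂ) ((0 : B13HistM toyFrame) + s • liveTable)

end Labels

end Summit.QuantumFields.BalabanUV.T4Continuum.NE1p.DressedSmallFieldNestedToriRod

end
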